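import Summits.ABC.IUTFork.Cor312HullGluedDHVolContainer
import Summits.ABC.IUTFork.Cor312HullGluedDHVolSharpGlobal
import HarnessLib

/-!
# [IUTchIII] Cor. 3.12 — the hull-gluing bracket at the SHARP setting of record WITHOUT `hst`: the packet window
# box ≤ hull ≤ glued hull ≤ container at EVERY prime, and `−|log(Θ)| ≤ −|log(Θ)|♮ ≤ −|log(Θ)| + E` with `E` an explicit
# finite sum over the packets above `2·disc(F)`

PROOF-ONLY sequel (abc-iut cell, seat abc-iut-w5-d082, WAVE-5; row «HULLGLUED-CONTAINER» named by abc-iut-w5-d121) of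
`Cor312HullGluedContainer` / `Cor312HullGluedDHVolContainer` (this seat), abc-iut-c312-5's
`Cor312HullGluedDHVolSharpGlobal` (p430293: the bracket MODULO `hst` at the packets over `2·disc(F)`, hypothesis `hbad`)
and abc-iut-w5-d060's `Cor312HullGluedDHVolGlobal` (`ThetaFinite♮`, `P.Statement → P♮.Statement`). TAKES NO SIDE on
[IUTchIII] Cor. 3.12; no definition, no `Prop` fact.

At abc-iut-c312-3's sharp setting of record `P = Real.settingDHVolSharp` (Θ-boxes `ι_j(t_{Θ,j,v_j})·(R_I)^∼` read off
non-zero Θ-ideles `t` that are units off `S`, `q`-centres off `tq`; Dupuy–Hilado §3.9) and its hull-gluing `P♮`: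

* §1 **`hullGlued_thetaLocal_window_settingDHVolSharp`** — at EVERY prime `p` (ramified, `p = 2`, under `S` or not) and
  label `i₀+1`, with `‖t_{Θ,i₀+1,v}‖ ≤ ρ` at the places over `p` and inner/outer radii `r`, `R` of the log-shell lattice
  of the packet: `Σ_{v⃗} w·log‖t_{Θ,i₀+1,v_{i₀+1}}‖ ≤ μ^log(^{n,∘}𝒰_{i₀+1,p}) ≤ μ^log(^{n,∘}𝒰♮_{i₀+1,p}) ≤ W·log(p⁴·R²·ρ/r²)`
  (box ≤ hull: abc-iut-c312-3 `logvol_thetaRegion3_sharp_inr` + monotone volumes; hull ≤ glued hull: abc-iut-w5-d060;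
  glued hull ≤ container: `Cor312HullGluedDHVolContainer`);
* §2 **`hullGlued_negLogTheta_window_settingDHVolSharp`** — `−|log(Θ)| ≤ −|log(Θ)|♮ ≤ −|log(Θ)| + E` with
  `E = processionNormalized (i ↦ Σ_{p ∣ 2·disc(F)} (W_{i+1,p}·log(p⁴·R²·ρ/r²) − μ^log(^{n,∘}𝒰_{i+1,p})))` — at every
  other packet `^{n,∘}𝒰` is (Ind1),(Ind2)-STABLE by theorem (p430293 `stable_thetaHull_settingDHVolSharp_of_not_dvd`) and
  the local Θ-volumes AGREE (p424693); the EXCESS replaces c312-5's hypothesis `hbad`, which is expected FALSE at odd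
  tamely ramified packets (c312-5's finding; `Cor312Ind2BallsRamified`);
* §3 **`negLogQ_le_negLogTheta_add_settingDHVolSharp_of_hullGlued_statement`** — the typed Statement for `P♮` gives
  `−|log(q)| ≤ −|log(Θ)| + E` for `P` (converse of w5-d060's `hullGlued_statement_settingDHVolSharp_of_statement`, up to
  `E`).
This is the print-faithful closure of the hull-gluing bracket at the exceptional packets: [IUTchIV] Thm. 1.10 Step (v)
(kurims pp. 27–29) bounds the possible images at a general `v ∈ 𝕍^non` by a CONTAINER (Prop. 1.4 (iii)), it does not
claim stability there. Reading (neutral): an explicit finite WINDOW, located by the log-shell radii `r`, `R` and the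
Θ-idele norms over `2·disc(F)`; nothing here asserts either Statement or constrains the Θ-glue.
[claim: Mochizuki2012, status: disputed] vocabulary only. [cite: Mochizuki2012, IUTchIV Thm 1.10 proof Step (v) pp. 27–29,
Prop. 1.4 (iii) p. 13] [cite: DupuyHilado2025, §3.9, §4.7, §4.9, §4.10]
-/

noncomputable section

open Set Function NumberField
open scoped Pointwise

namespace Summit.ABC.IUTFork.Thm311.Real

open Cor312 Cor312.Setting Cor312Vol Literature.IUT.LogThetaLattice Literature.IUT.LogVolume

variable {F : Type} [Field F] [NumberField F] (X : PilotData F) {logv : PadicLogs F} (hlog : LogvAnalytic logv)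
  (t : ∀ (pp : Nat.Primes) (_ : Fin X.lstar) (x : (thetaIndex X).Fibre (.inr pp)),
    haveI : Fact (pp : ℕ).Prime := ⟨pp.2⟩; kOf X pp.1 x)
  (tq : ∀ (pp : Nat.Primes) (x : (thetaIndex X).Fibre (.inr pp)),
    haveI : Fact (pp : ℕ).Prime := ⟨pp.2⟩; kOf X pp.1 x)
  (M : Type) [Field M] [NumberField M]
  (archPk : ∀ (j : (thetaIndex X).Label) (vQ : (thetaIndex X).VQ), Set ((logShellsDH X logv).Packet j vQ))
  (archSub : ∀ (j : (thetaIndex X).Label) (v : (thetaIndex X).V),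
    Set ((logShellsDH X logv).Packet j ((thetaIndex X).over v)))
  (Ψ : ℤ → ∀ v : (thetaIndex X).V, v ∈ (thetaIndex X).Vbad → Set ((logShellsDH X logv).StarPacket v))
  (act : ℤ → ∀ v : (thetaIndex X).V, v ∈ (thetaIndex X).Vbad →
    (logShellsDH X logv).StarPacket v → Module.End ℚ ((logShellsDH X logv).StarPacket v))
  (Mmod : ℤ → ∀ j : (thetaIndex X).LabelStar, Set ((logShellsDH X logv).GlobalPacket j.1))
  (region : ℤ → ∀ j : (thetaIndex X).LabelStar, FinDivisor M → ∀ vQ : (thetaIndex X).VQ,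
    Set ((logShellsDH X logv).Packet j.1 vQ))
  (n : ℤ) {HT : Type} {LogLink : HT → HT → Type} {IsFull : ∀ {s t : HT}, LogLink s t → Prop}
  (lat : LGPGaussianLogThetaLattice LogLink IsFull)
  {Frd : Type} {IsoF : Frd → Frd → Type} {Ob : Frd → Type} {realify : Frd → Frd} {Strip : Type}
  {IsoS : Strip → Strip → Type} {Mv : ∀ v : (thetaIndex X).V, v ∈ (thetaIndex X).Vbad → Type}
  [∀ v h, Monoid (Mv v h)]
  (sig : GlobalLGPFrobenioidSignature (thetaIndex X).lstar (thetaIndex X).V (· ∈ (thetaIndex X).Vbad)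
    Frd IsoF Ob realify Strip IsoS Mv)
  (split : SplittingMonoids Mv) {ObΔ : Type} {N : ∀ v : (thetaIndex X).V, v ∈ (thetaIndex X).Vbad → Type}
  [∀ v h, Monoid (N v h)] (qData : QPilotData ObΔ N)
  (ht0 : ∀ pp i x, t pp i x ≠ 0)
  (ht1 : ∀ (pp : Nat.Primes) (i : Fin X.lstar) (x : (thetaIndex X).Fibre (.inr pp)),
    haveI : Fact (pp : ℕ).Prime := ⟨pp.2⟩; placeOf X pp.1 x ∉ X.S → ‖t pp i x‖ = 1)
  (htq0 : ∀ pp x, tq pp x ≠ 0)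
  (htq1 : ∀ (pp : Nat.Primes) (x : (thetaIndex X).Fibre (.inr pp)),
    haveI : Fact (pp : ℕ).Prime := ⟨pp.2⟩; placeOf X pp.1 x ∉ X.S → ‖tq pp x‖ = 1)

/-! ## 1. The packet window at the sharp setting of record, ANY prime -/

include ht0 ht1 in
/-- **Box ≤ hull ≤ glued hull ≤ container at EVERY prime of the sharp setting of record.** At the packet
`(i₀+1, p)`, with `‖t_{Θ,i₀+1,v}‖ ≤ ρ` over `p` and inner/outer coordinate radii `r`, `R` of the log-shell lattice:
`Σ_{v⃗} w_{v⃗}·log‖t_{Θ,i₀+1,v_{i₀+1}}‖ ≤ μ^log(^{n,∘}𝒰_{i₀+1,p}) ≤ μ^log(^{n,∘}𝒰♮_{i₀+1,p}) ≤ W_{i₀+1,p}·log(p⁴·R²·ρ/r²)`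
(the (Ind3)-box abc-iut-c312-3 `logvol_thetaRegion3_sharp_inr` is admissible and inside `^{n,∘}𝒰`; `^{n,∘}𝒰 ⊆ ^{n,∘}𝒰♮`
abc-iut-w5-d060; the container of `Cor312HullGluedDHVolContainer`). No stability of `^{n,∘}𝒰` is used.
[claim: Mochizuki2012, status: disputed] [cite: Mochizuki2012, IUTchIV Thm 1.10 proof Step (v) pp. 27–29]
[cite: DupuyHilado2025, §3.9, §4.10] -/
theorem hullGlued_thetaLocal_window_settingDHVolSharp (pp : Nat.Primes) (i₀ : Fin (thetaIndex X).lstar)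
    {r R ρ : ℝ} (hr : 0 < r) (hR : 0 < R) (hρ : 0 < ρ)
    (hball : haveI : Fact (pp : ℕ).Prime := ⟨pp.2⟩
      ∀ z : (∀ s : (presAt X hlog pp).factorIdx (labelSucc i₀), (presAt X hlog pp).factorField (labelSucc i₀) s),
        (∀ s, ‖z s‖ < r) → z ∈ (presAt X hlog pp).latticeF (labelSucc i₀) 1)
    (hbdd : haveI : Fact (pp : ℕ).Prime := ⟨pp.2⟩
      ∀ z ∈ (presAt X hlog pp).latticeF (labelSucc i₀) 1, ∀ s, ‖z s‖ ≤ R)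
    (hΘ : haveI : Fact (pp : ℕ).Prime := ⟨pp.2⟩; ∀ x : (thetaIndex X).Fibre (.inr pp), ‖t pp i₀ x‖ ≤ ρ) :
    haveI : Fact (pp : ℕ).Prime := ⟨pp.2⟩
    (∑ e : (presAt X hlog pp).toLocalPieces.E (labelSucc i₀),
        weightDH X (labelSucc i₀) * Real.log ‖t pp i₀ (e (Fin.last _))‖ ≤
      ((settingDHVolSharp X hlog M archPk archSub Ψ act Mmod region n lat sig split qData tq t htq0
        htq1).thetaLocal (labelSucc i₀) (.inr pp)).untopD 0) ∧
    (((settingDHVolSharp X hlog M archPk archSub Ψ act Mmod region n lat sig split qData tq t htq0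
        htq1).thetaLocal (labelSucc i₀) (.inr pp)).untopD 0 ≤
      ((settingDHVolSharp X hlog M archPk archSub Ψ act Mmod region n lat sig split qData tq t htq0
        htq1).hullGlued.thetaLocal (labelSucc i₀) (.inr pp)).untopD 0) ∧
    (((settingDHVolSharp X hlog M archPk archSub Ψ act Mmod region n lat sig split qData tq t htq0
        htq1).hullGlued.thetaLocal (labelSucc i₀) (.inr pp)).untopD 0 ≤
      (∑ e : (presAt X hlog pp).toLocalPieces.E (labelSucc i₀), (presAt X hlog pp).w (labelSucc i₀) e) *
        Real.log (((pp : ℕ) : ℝ) ^ 4 * R ^ 2 * ρ / r ^ 2)) := by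
  haveI : Fact (pp : ℕ).Prime := ⟨pp.2⟩
  set P := settingDHVolSharp X hlog M archPk archSub Ψ act Mmod region n lat sig split qData tq t htq0 htq1 with hP
  have H : BridgeHyps P :=
    bridgeHyps_settingDHVolSharp_of_ideles X hlog t tq M archPk archSub Ψ act Mmod region n lat sig split qData ht0
      ht1 htq0 htq1
  have hdef : P.HullDefined (labelSucc i₀) (.inr pp) := hullDefined_of_finite H i₀ (.inr pp)
  have hdef' : P.hullGlued.HullDefined (labelSucc i₀) (.inr pp) :=
    hullGlued_hullDefined_settingDHVol X hlog M archPk archSub Ψ act Mmod region n lat sig split qData _ _ _ _ _ _ hdef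
  refine ⟨?_, ?_, ?_⟩
  · -- box ≤ hull: the (Ind3)-box is admissible, lies in `^{n,∘}𝒰`, and has the displayed log-volume
    rw [thetaLocal_untopD H i₀ (.inr pp)]
    have hbox := logvol_thetaRegion3_sharp_inr X hlog M archPk archSub Ψ act Mmod region n lat sig split qData
      (fun _ => qCentreDH X hlog tq) (qCentreDH_ne_zero X hlog tq htq0)
      (finite_support_logvol_qRegion X hlog M archPk archSub Ψ act Mmod region n tq htq0 htq1) t ht0 i₀ pp
    refine (le_of_eq hbox.symm).trans ?_
    exact H.mono i₀ (.inr pp)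
      (adm_thetaRegion3_sharp X hlog M archPk archSub Ψ act Mmod region n lat sig split qData _ _ _ t ht0 _ _)
      (P.thetaHull_adm hdef)
      ((P.thetaRegion3_subset_sUnion _ _).trans ((P.frame _ _).subset_hull _))
  · -- hull ≤ glued hull (abc-iut-w5-d060, monotone volumes)
    have hle := thetaLocal_le_hullGlued_thetaLocal H.mono i₀ (.inr pp) hdef hdef'
    unfold Setting.thetaLocal at hle ⊢
    rw [if_pos hdef, if_pos hdef'] at hle
    rw [if_pos hdef, if_pos hdef', WithTop.untopD_coe, WithTop.untopD_coe]
    exact WithTop.coe_le_coe.1 hle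
  · -- glued hull ≤ container
    exact hullGlued_thetaLocal_settingDHVol_untopD_le_of_polydisc X hlog M archPk archSub Ψ act Mmod region n lat sig
      split qData (fun _ _ => thetaBoxDH X hlog (sharpBoxDH X hlog t)) (fun _ => qCentreDH X hlog tq)
      (qCentreDH_ne_zero X hlog tq htq0)
      (finite_support_logvol_qRegion X hlog M archPk archSub Ψ act Mmod region n tq htq0 htq1) pp i₀ hr hR hρ hball
      hbdd (fun _ => thetaBoxDH_sharpBoxDH_subset_of_norm_le X hlog t ht0 pp i₀ hΘ) H

/-! ## 2. Globally: `−|log(Θ)| ≤ −|log(Θ)|♮ ≤ −|log(Θ)| + E`, `E` summed over the packets above `2·disc(F)` -/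

/-- The primes dividing `2·|disc(F)|` are finitely many. [folklore] -/
theorem finite_primes_dvd_two_mul_discr :
    {pp : Nat.Primes | (pp : ℕ) ∣ 2 * (NumberField.discr F).natAbs}.Finite :=
  finite_primes_dvd (mul_ne_zero two_ne_zero (Int.natAbs_ne_zero.mpr (NumberField.discr_ne_zero F)))

include ht0 ht1 in
open scoped Classical in
/-- **`−|log(Θ)| ≤ −|log(Θ)|♮ ≤ −|log(Θ)| + E` at the sharp setting of record, NO `hst`/`hbad` hypothesis**, with the
explicit excess `E = processionNormalized (i ↦ Σ_{p ∣ 2·disc(F)} (W_{i+1,p}·log(p⁴·R_{p,i}²·ρ_{p,i}/r_{p,i}²) −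
μ^log(^{n,∘}𝒰_{i+1,p})))` for any radii `r`, `R` of the log-shell lattices and bounds `ρ` of the Θ-idele norms at the
packets above `2·disc(F)`: at every other packet `^{n,∘}𝒰` is (Ind1),(Ind2)-STABLE (p430293) and the local Θ-volumes of `P`
and `P♮` AGREE (p424693). The excess is the [IUTchIV] Thm. 1.10 Step (v) container term; it replaces abc-iut-c312-5's
hypothesis `hbad`. [claim: Mochizuki2012, status: disputed] [cite: Mochizuki2012, IUTchIV Thm 1.10 proof Step (v) pp. 27–29]
[cite: DupuyHilado2025, §4.7, §4.9, §4.10] -/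
theorem hullGlued_negLogTheta_window_settingDHVolSharp (r R ρ : Nat.Primes → Fin (thetaIndex X).lstar → ℝ)
    (hr : ∀ pp i, 0 < r pp i) (hR : ∀ pp i, 0 < R pp i) (hρ : ∀ pp i, 0 < ρ pp i)
    (hball : ∀ (pp : Nat.Primes) (i : Fin (thetaIndex X).lstar), haveI : Fact (pp : ℕ).Prime := ⟨pp.2⟩
      ∀ z : (∀ s : (presAt X hlog pp).factorIdx (labelSucc i), (presAt X hlog pp).factorField (labelSucc i) s),
        (∀ s, ‖z s‖ < r pp i) → z ∈ (presAt X hlog pp).latticeF (labelSucc i) 1)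
    (hbdd : ∀ (pp : Nat.Primes) (i : Fin (thetaIndex X).lstar), haveI : Fact (pp : ℕ).Prime := ⟨pp.2⟩
      ∀ z ∈ (presAt X hlog pp).latticeF (labelSucc i) 1, ∀ s, ‖z s‖ ≤ R pp i)
    (hΘ : ∀ (pp : Nat.Primes) (i : Fin (thetaIndex X).lstar) (x : (thetaIndex X).Fibre (.inr pp)),
      haveI : Fact (pp : ℕ).Prime := ⟨pp.2⟩; ‖t pp i x‖ ≤ ρ pp i) :
    (settingDHVolSharp X hlog M archPk archSub Ψ act Mmod region n lat sig split qData tq t htq0 htq1).negLogTheta ≤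
      (settingDHVolSharp X hlog M archPk archSub Ψ act Mmod region n lat sig split qData tq t htq0
        htq1).hullGlued.negLogTheta ∧
    (settingDHVolSharp X hlog M archPk archSub Ψ act Mmod region n lat sig split qData tq t htq0
        htq1).hullGlued.negLogTheta ≤
      (settingDHVolSharp X hlog M archPk archSub Ψ act Mmod region n lat sig split qData tq t htq0 htq1).negLogTheta +
        ((processionNormalized fun i : Fin (thetaIndex X).lstar => ∑ᶠ vQ : (thetaIndex X).VQ,
          (match vQ with
            | .inl _ => (0 : ℝ)
            | .inr pp => haveI : Fact (pp : ℕ).Prime := ⟨pp.2⟩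
                if (pp : ℕ) ∣ 2 * (NumberField.discr F).natAbs then
                  (∑ e : (presAt X hlog pp).toLocalPieces.E (labelSucc i), (presAt X hlog pp).w (labelSucc i) e) *
                      Real.log (((pp : ℕ) : ℝ) ^ 4 * R pp i ^ 2 * ρ pp i / r pp i ^ 2) -
                    ((settingDHVolSharp X hlog M archPk archSub Ψ act Mmod region n lat sig split qData tq t htq0
                      htq1).thetaLocal (labelSucc i) (.inr pp)).untopD 0
                else 0) : ℝ) : WithTop ℝ) := by
  set P := settingDHVolSharp X hlog M archPk archSub Ψ act Mmod region n lat sig split qData tq t htq0 htq1 with hP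
  have H : BridgeHyps P :=
    bridgeHyps_settingDHVolSharp_of_ideles X hlog t tq M archPk archSub Ψ act Mmod region n lat sig split qData ht0
      ht1 htq0 htq1
  have hfin : P.ThetaFinite :=
    thetaFinite_settingDHVolSharp X hlog t tq M archPk archSub Ψ act Mmod region n lat sig split qData ht0 ht1 htq0 htq1
  have hfin' : P.hullGlued.ThetaFinite :=
    hullGlued_thetaFinite_settingDHVolSharp X hlog t tq M archPk archSub Ψ act Mmod region n lat sig split qData ht0
      ht1 htq0 htq1
  have hdef : ∀ (i : Fin (thetaIndex X).lstar) (vQ : (thetaIndex X).VQ), P.HullDefined (labelSucc i) vQ :=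
    fun i vQ => hullDefined_of_finite H i vQ
  -- hull-sets admit hulls at the real frames (surjective comparisons)
  have hHas : ∀ (i : Fin (thetaIndex X).lstar) (vQ : (thetaIndex X).VQ),
      ∀ H' ∈ (P.frame (labelSucc i) vQ).Hul, (P.frame (labelSucc i) vQ).HasHull H' := fun i vQ =>
    (Setting.frameHyps_ofComparison_of_surjective n lat sig split qData
      (realPiecesDH X hlog M archPk archSub Ψ act Mmod region (fun _ _ => thetaBoxDH X hlog (sharpBoxDH X hlog t))
        (fun _ => qCentreDH X hlog tq))
      (qCentreDH_ne_zero X hlog tq htq0) (hadm_DH X hlog M archPk archSub Ψ act Mmod region n)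
      (finite_support_logvol_qRegion X hlog M archPk archSub Ψ act Mmod region n tq htq0 htq1)
      (fun i vQ => factorMapDH_surjective' X hlog (labelSucc i) vQ) i vQ).1
  -- where `^{n,∘}𝒰` is stable the local Θ-volumes agree
  have hagree : ∀ (i : Fin (thetaIndex X).lstar) (vQ : (thetaIndex X).VQ),
      (∀ pp : Nat.Primes, vQ = .inr pp → ¬ (pp : ℕ) ∣ 2 * (NumberField.discr F).natAbs) →
        P.hullGlued.thetaLocal (labelSucc i) vQ = P.thetaLocal (labelSucc i) vQ := fun i vQ hvQ =>
    (P.hullGlued_hullDefined_thetaLocal_of_stable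
      (stable_thetaHull_settingDHVolSharp_of_not_dvd X hlog t tq M archPk archSub Ψ act Mmod region n lat sig split
        qData ht0 htq0 htq1 i vQ hvQ) (hHas i vQ) (hdef i vQ)).2
  refine hullGlued_negLogTheta_window _ (fun i => ?_) (fun i vQ => ?_) H.mono hfin hfin'
  · -- finite support: inside the primes dividing `2·|disc(F)|`
    refine ((finite_primes_dvd_two_mul_discr (F := F)).image Sum.inr).subset fun vQ hvQ => ?_
    have hne := Function.mem_support.mp hvQ
    rcases vQ with u | pp
    · exact absurd rfl hne
    · by_cases hdvd : (pp : ℕ) ∣ 2 * (NumberField.discr F).natAbs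
      · exact ⟨pp, hdvd, rfl⟩
      · exact absurd (if_neg hdvd) hne
  · -- the packet excesses
    rcases vQ with u | pp
    · rw [add_zero, hagree i (.inl u) (fun pp h => by cases h)]
    · haveI : Fact (pp : ℕ).Prime := ⟨pp.2⟩
      by_cases hdvd : (pp : ℕ) ∣ 2 * (NumberField.discr F).natAbs
      · simp only [hdvd, if_true, add_sub_cancel]
        exact (hullGlued_thetaLocal_window_settingDHVolSharp X hlog t tq M archPk archSub Ψ act Mmod region n lat sig
          split qData ht0 ht1 htq0 htq1 pp i (hr pp i) (hR pp i) (hρ pp i) (hball pp i) (hbdd pp i) (hΘ pp i)).2.2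
      · simp only [hdvd, if_false, add_zero]
        rw [hagree i (.inr pp) (fun pp' h => by cases h; exact hdvd)]

/-! ## 3. The typed Statement for `P♮` read back on `P`, up to `E` -/

include ht0 ht1 in
open scoped Classical in
/-- **At the sharp setting of record, the typed Statement FOR THE HULL-GLUED SETTING gives
`−|log(q)| ≤ −|log(Θ)| + E` for the setting itself**, with the explicit excess `E` of §2 (the converse of
abc-iut-w5-d060's `hullGlued_statement_settingDHVolSharp_of_statement` up to `E`; `E = 0` would be p424693's
equivalence under `hst`). Neither Statement is asserted. [claim: Mochizuki2012, status: disputed]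
[cite: Mochizuki2012, IUTchIV Thm 1.10 proof Step (v) pp. 27–29] [cite: DupuyHilado2025, §4.10] -/
theorem negLogQ_le_negLogTheta_add_settingDHVolSharp_of_hullGlued_statement
    (r R ρ : Nat.Primes → Fin (thetaIndex X).lstar → ℝ)
    (hr : ∀ pp i, 0 < r pp i) (hR : ∀ pp i, 0 < R pp i) (hρ : ∀ pp i, 0 < ρ pp i)
    (hball : ∀ (pp : Nat.Primes) (i : Fin (thetaIndex X).lstar), haveI : Fact (pp : ℕ).Prime := ⟨pp.2⟩
      ∀ z : (∀ s : (presAt X hlog pp).factorIdx (labelSucc i), (presAt X hlog pp).factorField (labelSucc i) s),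
        (∀ s, ‖z s‖ < r pp i) → z ∈ (presAt X hlog pp).latticeF (labelSucc i) 1)
    (hbdd : ∀ (pp : Nat.Primes) (i : Fin (thetaIndex X).lstar), haveI : Fact (pp : ℕ).Prime := ⟨pp.2⟩
      ∀ z ∈ (presAt X hlog pp).latticeF (labelSucc i) 1, ∀ s, ‖z s‖ ≤ R pp i)
    (hΘ : ∀ (pp : Nat.Primes) (i : Fin (thetaIndex X).lstar) (x : (thetaIndex X).Fibre (.inr pp)),
      haveI : Fact (pp : ℕ).Prime := ⟨pp.2⟩; ‖t pp i x‖ ≤ ρ pp i)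
    (h' : (settingDHVolSharp X hlog M archPk archSub Ψ act Mmod region n lat sig split qData tq t htq0
      htq1).hullGlued.Statement) :
    (((settingDHVolSharp X hlog M archPk archSub Ψ act Mmod region n lat sig split qData tq t htq0 htq1).negLogQ : ℝ) :
        WithTop ℝ) ≤
      (settingDHVolSharp X hlog M archPk archSub Ψ act Mmod region n lat sig split qData tq t htq0 htq1).negLogTheta +
        ((processionNormalized fun i : Fin (thetaIndex X).lstar => ∑ᶠ vQ : (thetaIndex X).VQ,
          (match vQ with
            | .inl _ => (0 : ℝ)
            | .inr pp => haveI : Fact (pp : ℕ).Prime := ⟨pp.2⟩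
                if (pp : ℕ) ∣ 2 * (NumberField.discr F).natAbs then
                  (∑ e : (presAt X hlog pp).toLocalPieces.E (labelSucc i), (presAt X hlog pp).w (labelSucc i) e) *
                      Real.log (((pp : ℕ) : ℝ) ^ 4 * R pp i ^ 2 * ρ pp i / r pp i ^ 2) -
                    ((settingDHVolSharp X hlog M archPk archSub Ψ act Mmod region n lat sig split qData tq t htq0
                      htq1).thetaLocal (labelSucc i) (.inr pp)).untopD 0
                else 0) : ℝ) : WithTop ℝ) := by
  have h2 := h'.2
  rw [Setting.hullGlued_negLogQ] at h2
  exact h2.trans (hullGlued_negLogTheta_window_settingDHVolSharp X hlog t tq M archPk archSub Ψ act Mmod region n lat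
    sig split qData ht0 ht1 htq0 htq1 r R ρ hr hR hρ hball hbdd hΘ).2

end Summit.ABC.IUTFork.Thm311.Real

end
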